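import Summits.NavierStokesRegularity.OSWSelfSimilar.SheetREvenTestsBump
import HarnessLib

/-!
# SHEET-ℝ frame, EVEN ZERO-MASS class `E⁺₀` — dictionary layer 2: the mass functional on `L²_w`, the even zero-mass energy space
# `EspE L` as a HILBERT SPACE, its function-language dictionary, and the embedding `jmapE` of the zero-mass even tests

HONEST FRAMING (cell ns-blowup GROUP B / zone Z3, case Z3-SR-SPEC EVEN half; 1-D MODEL certificate frame (viscous gCLM/OSW sheet on the
line); not Euler/NS; «violates: none — MODEL»).  Nothing here asserts that a profile exists; no number of record moves.

Twin of `SheetREnergySpace` (odd `Esp`) + `SheetRTestSpace.jmap` for DESIGN-Z3-SR-SPEC-EVEN (D1)'s class `E⁺₀` = even, ZERO-MASS `H¹_w`,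
`‖δ‖²_E = ‖δ′‖²_w + ¼‖δ‖²_w`, `w = L² + ξ²`:

* `massW hL : W L →L[ℝ] ℝ`, `g ↦ ∫ g` — the MASS is a bounded functional on `L²_w` (`|∫g| ≤ √(π/L)‖g‖_w`, `L²_w ⊂ L¹`);
* **`EspE L hL`** — pairs `p = (p₀, p₁) ∈ L²_w × L²_w` with `∫₀ˣ(2p₀ − prim p₁) = x·∫₀¹(2p₀ − prim p₁)` for every `x` (i.e. `2p₀ = c + prim p₁`
  a.e. for the constant `c = baseConst p`), `prim p₁` EVEN, and `∫ p₀ = 0` (zero mass) — an intersection of kernels of continuous linear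
  functionals, hence a CLOSED submodule of the Hilbert space `WithLp 2 (W L × W L)`, hence complete; `‖p‖² = ¼‖u‖²_w + ‖u₁‖²_w` for the
  profile `u = profile p := baseConst p + prim p₁` (`= 2p₀` a.e.), `u₁ = p₁`;
* `energyClassE_of_mem` — back to functions: `profile p = profile p (0) + ∫₀p₁`, even, `p₁` a.e.-strongly measurable, `∫w(profile p)² = 4‖p₀‖²`,
  `∫wp₁² = ‖p₁‖²`, and ZERO MASS `∫ profile p = 0`;
* **`jmapE hL : testSpaceE0 →ₗ[ℝ] EspE L hL`**, `(v, v₁) ↦ (½[v], [v₁])`, with `profile (jmapE vp) = v` pointwise, `(jmapE vp).snd = v₁` a.e., and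
  `‖jmapE vp‖² = ¼∫wv² + ∫wv₁²`.
Three definitions (`massW`, `EspE` with `baseConst`/`profile`, `jmapE`); no named fact.  WHAT THIS IS NOT: not NS.
-/

noncomputable section

namespace Summit.NavierStokesRegularity.OSWSelfSimilar
namespace SheetREvenEnergySpace

open _root_.MeasureTheory _root_.Set _root_.Filter _root_.Real SheetRWeakProfilePV SheetRWeakToStrong SheetREnergyClass SheetRWeightedMeasure
  SheetRLinearisedTests SheetREnergySpace SheetRTestSpace SheetREvenTests
open scoped Topology ENNReal

/-! ### §1 The mass functional on `W L = L²_w` -/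

/-- An element of `W L` is Lebesgue integrable (`L²_w ⊂ L¹`, `L > 0`). [folklore] -/
theorem integrable_of_W {L : ℝ} (hL : 0 < L) (g : W L) : Integrable (g : ℝ → ℝ) :=
  SheetRWeightedEmbeddings.integrable_of_weighted_sq hL (aestronglyMeasurable_of_W hL g) (weightedSq_of_W hL g)

/-- `|∫ g| ≤ √(π/L)·‖g‖_w` for `g ∈ W L`. [folklore] -/
theorem abs_integral_le_W {L : ℝ} (hL : 0 < L) (g : W L) : |∫ y, (g : ℝ → ℝ) y| ≤ Real.sqrt (π / L) * ‖g‖ := by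
  rw [norm_W]
  calc |∫ y, (g : ℝ → ℝ) y| ≤ ∫ y, |(g : ℝ → ℝ) y| := by
        rw [← Real.norm_eq_abs]
        exact (norm_integral_le_integral_norm _).trans (le_of_eq (by simp only [Real.norm_eq_abs]))
    _ ≤ _ := SheetRWeightedEmbeddings.integral_abs_le_of_weighted_sq hL (aestronglyMeasurable_of_W hL g) (weightedSq_of_W hL g)

/-- **The mass** `g ↦ ∫ g` as a bounded linear functional on `W L`. [folklore] -/
def massW {L : ℝ} (hL : 0 < L) : W L →L[ℝ] ℝ :=
  LinearMap.mkContinuous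
    { toFun := fun g => ∫ y, (g : ℝ → ℝ) y
      map_add' := fun f g => by
        have hae : ((f + g : W L) : ℝ → ℝ) =ᵐ[volume] fun y => (f : ℝ → ℝ) y + (g : ℝ → ℝ) y :=
          ae_volume_of_ae_μw hL (Lp.coeFn_add f g)
        rw [integral_congr_ae hae, integral_add (integrable_of_W hL f) (integrable_of_W hL g)]
      map_smul' := fun c f => by
        have hae : ((c • f : W L) : ℝ → ℝ) =ᵐ[volume] fun y => c * (f : ℝ → ℝ) y :=
          (ae_volume_of_ae_μw hL (Lp.coeFn_smul c f)).mono fun y hy => by rw [hy, Pi.smul_apply, smul_eq_mul]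
        rw [integral_congr_ae hae, integral_const_mul, RingHom.id_apply, smul_eq_mul] }
    (Real.sqrt (π / L)) fun g => by
      rw [Real.norm_eq_abs]
      exact abs_integral_le_W hL g

/-- `massW g = ∫ g`. [folklore] -/
@[simp] theorem massW_apply {L : ℝ} (hL : 0 < L) (g : W L) : massW hL g = ∫ y, (g : ℝ → ℝ) y := rfl

/-! ### §2 The even zero-mass energy space `EspE L` as a closed submodule of `W L × W L` -/

/-- **The even zero-mass energy space `E⁺₀`.** Pairs `p = (p₀, p₁) ∈ L²_w × L²_w` such that `2p₀ − prim p₁` is a.e. CONSTANT (tested by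
`∫₀ˣ(2p₀ − prim p₁) = x·∫₀¹(2p₀ − prim p₁)` for every `x`), `prim p₁` is even, and `p₀` has zero mass.  For the profile `u := baseConst p + prim p₁`
(`= 2p₀` a.e.), `u₁ := p₁`: `‖p‖² = ¼‖u‖²_w + ‖u₁‖²_w = ‖u‖²_E`. [folklore] -/
def EspE (L : ℝ) (hL : 0 < L) : Submodule ℝ (WithLp 2 (W L × W L)) where
  carrier := {p | (∀ x, ∫ s in (0 : ℝ)..x, (2 * (p.fst : ℝ → ℝ) s - prim (p.snd : ℝ → ℝ) s) =
      x * ∫ s in (0 : ℝ)..1, (2 * (p.fst : ℝ → ℝ) s - prim (p.snd : ℝ → ℝ) s)) ∧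
    (∀ x, prim (p.snd : ℝ → ℝ) (-x) = prim (p.snd : ℝ → ℝ) x) ∧ ∫ y, (p.fst : ℝ → ℝ) y = 0}
  add_mem' := by
    intro p q hp hq
    have haef : ((p + q).fst : ℝ → ℝ) =ᵐ[volume] fun y => (p.fst : ℝ → ℝ) y + (q.fst : ℝ → ℝ) y := by
      rw [WithLp.add_fst]; exact ae_volume_of_ae_μw hL (Lp.coeFn_add _ _)
    have hF : ∀ x, ∫ s in (0 : ℝ)..x, (2 * ((p + q).fst : ℝ → ℝ) s - prim ((p + q).snd : ℝ → ℝ) s) =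
        (∫ s in (0 : ℝ)..x, (2 * (p.fst : ℝ → ℝ) s - prim (p.snd : ℝ → ℝ) s)) +
          ∫ s in (0 : ℝ)..x, (2 * (q.fst : ℝ → ℝ) s - prim (q.snd : ℝ → ℝ) s) := by
      intro x
      rw [WithLp.add_snd, prim_add hL]
      have hcongr : ∫ s in (0 : ℝ)..x, (2 * ((p + q).fst : ℝ → ℝ) s - (prim (p.snd : ℝ → ℝ) s + prim (q.snd : ℝ → ℝ) s)) =
          ∫ s in (0 : ℝ)..x, ((2 * (p.fst : ℝ → ℝ) s - prim (p.snd : ℝ → ℝ) s) + (2 * (q.fst : ℝ → ℝ) s - prim (q.snd : ℝ → ℝ) s)) :=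
        intervalIntegral.integral_congr_ae (haef.mono fun y hy _ => by rw [hy]; ring)
      rw [hcongr, intervalIntegral.integral_add]
      · exact ((intervalIntegrable_of_W hL p.fst 0 x).const_mul 2).sub ((continuous_prim hL p.snd).intervalIntegrable 0 x)
      · exact ((intervalIntegrable_of_W hL q.fst 0 x).const_mul 2).sub ((continuous_prim hL q.snd).intervalIntegrable 0 x)
    refine ⟨fun x => ?_, fun x => ?_, ?_⟩
    · rw [hF x, hF 1, hp.1 x, hq.1 x]
      ring
    · rw [WithLp.add_snd, prim_add hL]
      simp only [hp.2.1 x, hq.2.1 x]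
    · rw [integral_congr_ae haef, integral_add (integrable_of_W hL _) (integrable_of_W hL _), hp.2.2, hq.2.2, add_zero]
  zero_mem' := by
    have hae : ((0 : WithLp 2 (W L × W L)).fst : ℝ → ℝ) =ᵐ[volume] 0 := by
      rw [WithLp.zero_fst]; exact ae_volume_of_ae_μw hL (Lp.coeFn_zero _ _ _)
    have hae2 : ((0 : WithLp 2 (W L × W L)).snd : ℝ → ℝ) =ᵐ[volume] 0 := by
      rw [WithLp.zero_snd]; exact ae_volume_of_ae_μw hL (Lp.coeFn_zero _ _ _)
    have hF : ∀ x, ∫ s in (0 : ℝ)..x, (2 * ((0 : WithLp 2 (W L × W L)).fst : ℝ → ℝ) s - prim ((0 : WithLp 2 (W L × W L)).snd : ℝ → ℝ) s)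
        = 0 := by
      intro x
      rw [prim_congr_ae hae2]
      have hcongr : ∫ s in (0 : ℝ)..x, (2 * ((0 : WithLp 2 (W L × W L)).fst : ℝ → ℝ) s - prim (0 : ℝ → ℝ) s) =
          ∫ s in (0 : ℝ)..x, (0 : ℝ) :=
        intervalIntegral.integral_congr_ae (hae.mono fun y hy _ => by rw [hy]; simp [prim])
      rw [hcongr, intervalIntegral.integral_zero]
    refine ⟨fun x => by rw [hF x, hF 1, mul_zero], fun x => ?_, ?_⟩
    · rw [prim_congr_ae hae2]
      simp [prim]
    · rw [integral_congr_ae hae]; simp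
  smul_mem' := by
    intro c p hp
    have haef : ((c • p).fst : ℝ → ℝ) =ᵐ[volume] fun y => c * (p.fst : ℝ → ℝ) y := by
      rw [WithLp.smul_fst]
      exact (ae_volume_of_ae_μw hL (Lp.coeFn_smul c _)).mono fun y hy => by rw [hy, Pi.smul_apply, smul_eq_mul]
    have hF : ∀ x, ∫ s in (0 : ℝ)..x, (2 * ((c • p).fst : ℝ → ℝ) s - prim ((c • p).snd : ℝ → ℝ) s) =
        c * ∫ s in (0 : ℝ)..x, (2 * (p.fst : ℝ → ℝ) s - prim (p.snd : ℝ → ℝ) s) := by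
      intro x
      rw [WithLp.smul_snd, prim_smul hL]
      have hcongr : ∫ s in (0 : ℝ)..x, (2 * ((c • p).fst : ℝ → ℝ) s - c * prim (p.snd : ℝ → ℝ) s) =
          ∫ s in (0 : ℝ)..x, c * (2 * (p.fst : ℝ → ℝ) s - prim (p.snd : ℝ → ℝ) s) :=
        intervalIntegral.integral_congr_ae (haef.mono fun y hy _ => by rw [hy]; ring)
      rw [hcongr, intervalIntegral.integral_const_mul]
    refine ⟨fun x => ?_, fun x => ?_, ?_⟩
    · rw [hF x, hF 1, hp.1 x]
      ring
    · rw [WithLp.smul_snd, prim_smul hL]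
      simp only [hp.2.1 x]
    · rw [integral_congr_ae haef, integral_const_mul, hp.2.2, mul_zero]

/-- Membership in `EspE L`, unfolded. [folklore] -/
theorem mem_EspE_iff {L : ℝ} (hL : 0 < L) (p : WithLp 2 (W L × W L)) :
    p ∈ EspE L hL ↔ (∀ x, ∫ s in (0 : ℝ)..x, (2 * (p.fst : ℝ → ℝ) s - prim (p.snd : ℝ → ℝ) s) =
      x * ∫ s in (0 : ℝ)..1, (2 * (p.fst : ℝ → ℝ) s - prim (p.snd : ℝ → ℝ) s)) ∧
      (∀ x, prim (p.snd : ℝ → ℝ) (-x) = prim (p.snd : ℝ → ℝ) x) ∧ ∫ y, (p.fst : ℝ → ℝ) y = 0 := Iff.rfl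

/-- The evenness functionals are continuous: `p ↦ prim p₁ (−x) − prim p₁ x`. [folklore] -/
theorem continuous_functional₂' {L : ℝ} (hL : 0 < L) (x : ℝ) :
    Continuous fun p : WithLp 2 (W L × W L) => prim (p.snd : ℝ → ℝ) (-x) - prim (p.snd : ℝ → ℝ) x := by
  set Λ : WithLp 2 (W L × W L) →ₗ[ℝ] ℝ :=
    { toFun := fun p => prim (p.snd : ℝ → ℝ) (-x) - prim (p.snd : ℝ → ℝ) x
      map_add' := by
        intro p q
        show prim ((p + q).snd : ℝ → ℝ) (-x) - prim ((p + q).snd : ℝ → ℝ) x = _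
        rw [WithLp.add_snd, prim_add hL]
        ring
      map_smul' := by
        intro c p
        show prim ((c • p).snd : ℝ → ℝ) (-x) - prim ((c • p).snd : ℝ → ℝ) x = (RingHom.id ℝ) c • _
        rw [WithLp.smul_snd, prim_smul hL, RingHom.id_apply, smul_eq_mul]
        ring } with hΛ
  have hbound : ∀ p : WithLp 2 (W L × W L), ‖Λ p‖ ≤ (2 * Real.sqrt (π / L)) * ‖p‖ := by
    intro p
    rw [Real.norm_eq_abs]
    have hs : ‖p.snd‖ ≤ ‖p‖ := WithLp.norm_snd_le (x := p)
    have h1 := abs_prim_le hL p.snd (-x)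
    have h2 := abs_prim_le hL p.snd x
    have hπ : 0 ≤ Real.sqrt (π / L) := Real.sqrt_nonneg _
    change |prim (p.snd : ℝ → ℝ) (-x) - prim (p.snd : ℝ → ℝ) x| ≤ _
    calc |prim (p.snd : ℝ → ℝ) (-x) - prim (p.snd : ℝ → ℝ) x| ≤ Real.sqrt (π / L) * ‖p.snd‖ + Real.sqrt (π / L) * ‖p.snd‖ :=
          (abs_sub _ _).trans (add_le_add h1 h2)
      _ ≤ Real.sqrt (π / L) * ‖p‖ + Real.sqrt (π / L) * ‖p‖ := by gcongr
      _ = (2 * Real.sqrt (π / L)) * ‖p‖ := by ring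
  exact (Λ.mkContinuous _ hbound).continuous

/-- The mass of the first component is continuous on `W L × W L`. [folklore] -/
theorem continuous_mass_fst {L : ℝ} (hL : 0 < L) : Continuous fun p : WithLp 2 (W L × W L) => ∫ y, (p.fst : ℝ → ℝ) y := by
  have h : (fun p : WithLp 2 (W L × W L) => ∫ y, (p.fst : ℝ → ℝ) y) = fun p => massW hL (WithLp.fst p) := by
    funext p; rw [massW_apply]
  rw [h]
  exact (massW hL).continuous.comp (WithLp.continuous_fst (p := 2) (α := W L) (β := W L))

/-- **`EspE L` is closed** in `W L × W L` (an intersection of kernels of continuous functionals). [folklore] -/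
theorem isClosed_EspE {L : ℝ} (hL : 0 < L) : IsClosed (EspE L hL : Set (WithLp 2 (W L × W L))) := by
  have h : (EspE L hL : Set (WithLp 2 (W L × W L))) =
      ((⋂ x : ℝ, {p | (∫ s in (0 : ℝ)..x, (2 * (p.fst : ℝ → ℝ) s - prim (p.snd : ℝ → ℝ) s)) -
          x * ∫ s in (0 : ℝ)..1, (2 * (p.fst : ℝ → ℝ) s - prim (p.snd : ℝ → ℝ) s) = 0}) ∩
        ⋂ x : ℝ, {p | prim (p.snd : ℝ → ℝ) (-x) - prim (p.snd : ℝ → ℝ) x = 0}) ∩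
        {p | ∫ y, (p.fst : ℝ → ℝ) y = 0} := by
    ext p
    simp only [SetLike.mem_coe, mem_EspE_iff, mem_inter_iff, mem_iInter, mem_setOf_eq, sub_eq_zero]
    constructor
    · rintro ⟨h1, h2, h3⟩; exact ⟨⟨h1, h2⟩, h3⟩
    · rintro ⟨⟨h1, h2⟩, h3⟩; exact ⟨h1, h2, h3⟩
  rw [h]
  refine ((isClosed_iInter fun x => isClosed_eq ((continuous_functional₁ hL x).sub
      (continuous_const.mul (continuous_functional₁ hL 1))) continuous_const).inter
    (isClosed_iInter fun x => isClosed_eq (continuous_functional₂' hL x) continuous_const)).inter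
    (isClosed_eq (continuous_mass_fst hL) continuous_const)

/-- **`EspE L` is complete** (a closed subspace of a Hilbert space). [folklore] -/
theorem completeSpace_EspE {L : ℝ} (hL : 0 < L) : CompleteSpace (EspE L hL) :=
  (isClosed_EspE hL).completeSpace_coe

/-! ### §3 Back to the function language -/

/-- The a.e.-constant value of `2p₀ − prim p₁`: `baseConst p = ∫₀¹(2p₀ − prim p₁)` (`= u(0)` for the profile `u`). [folklore] -/
def baseConst {L : ℝ} {hL : 0 < L} (p : EspE L hL) : ℝ :=
  ∫ s in (0 : ℝ)..1, (2 * ((p : WithLp 2 (W L × W L)).fst : ℝ → ℝ) s - prim ((p : WithLp 2 (W L × W L)).snd : ℝ → ℝ) s)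

/-- **The profile of `p ∈ EspE L`**: `u = baseConst p + prim p₁` (continuous, even, `= 2p₀` a.e.). [folklore] -/
def profile {L : ℝ} {hL : 0 < L} (p : EspE L hL) (x : ℝ) : ℝ :=
  baseConst p + prim ((p : WithLp 2 (W L × W L)).snd : ℝ → ℝ) x

/-- `profile p 0 = baseConst p`. [folklore] -/
theorem profile_zero {L : ℝ} {hL : 0 < L} (p : EspE L hL) : profile p 0 = baseConst p := by
  simp [profile]

/-- For `p ∈ EspE L`: `profile p = 2p₀` almost everywhere (Lebesgue differentiation of `x ↦ ∫₀ˣ(2p₀ − prim p₁ − c) ≡ 0`). [folklore] -/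
theorem profile_ae_eq {L : ℝ} (hL : 0 < L) (p : EspE L hL) :
    (fun y => profile p y) =ᵐ[volume] fun y => 2 * ((p : WithLp 2 (W L × W L)).fst : ℝ → ℝ) y := by
  obtain ⟨h1, -, -⟩ := (mem_EspE_iff hL _).1 p.2
  set c : ℝ := baseConst p with hc
  set f : ℝ → ℝ := fun y => 2 * ((p : WithLp 2 (W L × W L)).fst : ℝ → ℝ) y -
    prim ((p : WithLp 2 (W L × W L)).snd : ℝ → ℝ) y - c with hf
  have hi1 : ∀ x, IntervalIntegrable (fun y => 2 * ((p : WithLp 2 (W L × W L)).fst : ℝ → ℝ) y -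
      prim ((p : WithLp 2 (W L × W L)).snd : ℝ → ℝ) y) volume 0 x := fun x =>
    ((intervalIntegrable_of_W hL _ 0 x).const_mul 2).sub ((continuous_prim hL _).intervalIntegrable 0 x)
  have hfloc : LocallyIntegrable f volume := by
    have h1' : LocallyIntegrable (fun y => 2 * ((p : WithLp 2 (W L × W L)).fst : ℝ → ℝ) y) volume :=
      ((memLp_two_of_weighted_sq hL (aestronglyMeasurable_of_W hL _) (weightedSq_of_W hL _)).const_mul 2).locallyIntegrable
        one_le_two
    exact (h1'.sub (continuous_prim hL _).locallyIntegrable).sub (locallyIntegrable_const c)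
  have hder := _root_.LocallyIntegrable.ae_hasDerivAt_integral hfloc
  have hF : (fun x => ∫ t in (0 : ℝ)..x, f t) = fun _ => (0 : ℝ) := by
    funext x
    simp only [hf]
    rw [intervalIntegral.integral_sub (hi1 x) (intervalIntegrable_const), h1 x, intervalIntegral.integral_const, smul_eq_mul,
      sub_zero, hc, baseConst]
    ring
  filter_upwards [hder] with y hy
  have hy0 := hy 0
  rw [hF] at hy0
  have hzero : f y = 0 := (hy0.unique (hasDerivAt_const y (0 : ℝ)))
  simp only [hf] at hzero
  simp only [profile]
  linarith

/-- **The dictionary.** For `p ∈ EspE L` the profile `u := profile p`, `u₁ := p₁` is in the even zero-mass energy class in primitive form: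
`u = u(0) + ∫₀u₁`, `u` even, `u₁` a.e.-strongly measurable, `∫wu² < ∞`, `∫wu₁² < ∞` with `∫wu² = 4‖p₀‖²`, `∫wu₁² = ‖p₁‖²`, and `∫ u = 0`. [folklore] -/
theorem energyClassE_of_mem {L : ℝ} (hL : 0 < L) (p : EspE L hL) :
    (∀ x, profile p x = profile p 0 + ∫ s in (0 : ℝ)..x, ((p : WithLp 2 (W L × W L)).snd : ℝ → ℝ) s) ∧
    (∀ y, profile p (-y) = profile p y) ∧
    AEStronglyMeasurable (((p : WithLp 2 (W L × W L)).snd : ℝ → ℝ)) volume ∧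
    Integrable (fun y => (L ^ 2 + y ^ 2) * profile p y ^ 2) ∧
    Integrable (fun y => (L ^ 2 + y ^ 2) * ((p : WithLp 2 (W L × W L)).snd : ℝ → ℝ) y ^ 2) ∧
    (∫ y, (L ^ 2 + y ^ 2) * profile p y ^ 2) = 4 * ‖(p : WithLp 2 (W L × W L)).fst‖ ^ 2 ∧
    (∫ y, (L ^ 2 + y ^ 2) * ((p : WithLp 2 (W L × W L)).snd : ℝ → ℝ) y ^ 2) = ‖(p : WithLp 2 (W L × W L)).snd‖ ^ 2 ∧
    ∫ y, profile p y = 0 := by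
  obtain ⟨-, h2, h3⟩ := (mem_EspE_iff hL _).1 p.2
  have hae := profile_ae_eq hL p
  have h0' : Integrable fun y => (L ^ 2 + y ^ 2) * (2 * ((p : WithLp 2 (W L × W L)).fst : ℝ → ℝ) y) ^ 2 := by
    have := (weightedSq_of_W hL (p : WithLp 2 (W L × W L)).fst).const_mul 4
    refine this.congr (Eventually.of_forall fun y => ?_)
    simp only; ring
  have hcongr : (fun y => (L ^ 2 + y ^ 2) * profile p y ^ 2) =ᵐ[volume]
      fun y => (L ^ 2 + y ^ 2) * (2 * ((p : WithLp 2 (W L × W L)).fst : ℝ → ℝ) y) ^ 2 :=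
    hae.mono fun y hy => by simp only [hy]
  refine ⟨fun x => by simp [profile, prim], fun y => by simp only [profile, h2 y], aestronglyMeasurable_of_W hL _,
    h0'.congr hcongr.symm, weightedSq_of_W hL _, ?_, ?_, ?_⟩
  · rw [integral_congr_ae hcongr, sq_norm_W]
    have e : (fun y => (L ^ 2 + y ^ 2) * (2 * ((p : WithLp 2 (W L × W L)).fst : ℝ → ℝ) y) ^ 2) =
        fun y => 4 * ((L ^ 2 + y ^ 2) * ((p : WithLp 2 (W L × W L)).fst : ℝ → ℝ) y ^ 2) := by
      funext y; ring
    rw [e, integral_const_mul]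
  · rw [sq_norm_W]
  · rw [integral_congr_ae hae, integral_const_mul, h3, mul_zero]

/-- The profile of `p` is continuous. [folklore] -/
theorem continuous_profile {L : ℝ} (hL : 0 < L) (p : EspE L hL) : Continuous (profile p) :=
  continuous_const.add (continuous_prim hL _)

/-! ### §4 The embedding `jmapE : testSpaceE0 →ₗ EspE L hL`, `(v, v₁) ↦ (½v, v₁)` -/

/-- The underlying pair of `L²_w` classes of a zero-mass even test lies in `EspE L`. [folklore] -/
theorem jmapE_mem {L : ℝ} (hL : 0 < L) (vp : testSpaceE0) :
    WithLp.toLp 2 (((1 / 2 : ℝ) • (memLp_W_of_any (L := L) vp.2.1.toIsCompactTestAny).1.toLp vp.1.1),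
      (memLp_W_of_any (L := L) vp.2.1.toIsCompactTestAny).2.toLp vp.1.2) ∈ EspE L hL := by
  obtain ⟨hc, hprim, -, -⟩ := basic_of_any vp.2.1.toIsCompactTestAny
  set a : W L := (memLp_W_of_any (L := L) vp.2.1.toIsCompactTestAny).1.toLp vp.1.1 with ha
  set b : W L := (memLp_W_of_any (L := L) vp.2.1.toIsCompactTestAny).2.toLp vp.1.2 with hb
  have hae_a : (a : ℝ → ℝ) =ᵐ[volume] vp.1.1 := ae_volume_of_ae_μw hL (MemLp.coeFn_toLp _)
  have hae_b : (b : ℝ → ℝ) =ᵐ[volume] vp.1.2 := ae_volume_of_ae_μw hL (MemLp.coeFn_toLp _)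
  have hprimb : prim (b : ℝ → ℝ) = fun x => vp.1.1 x - vp.1.1 0 := by
    rw [prim_congr_ae hae_b]; funext x; exact hprim x
  have hfst : ((WithLp.toLp 2 (((1 / 2 : ℝ) • a), b)).fst : ℝ → ℝ) =ᵐ[volume] fun y => (1 / 2) * vp.1.1 y := by
    have h1 : (((1 / 2 : ℝ) • a : W L) : ℝ → ℝ) =ᵐ[volume] fun y => (1 / 2) * (a : ℝ → ℝ) y :=
      (ae_volume_of_ae_μw hL (Lp.coeFn_smul (1 / 2 : ℝ) a)).mono fun y hy => by rw [hy, Pi.smul_apply, smul_eq_mul]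
    exact h1.trans (hae_a.mono fun y hy => by simp only [hy])
  have hsnd : (WithLp.toLp 2 (((1 / 2 : ℝ) • a), b)).snd = b := rfl
  have hF : ∀ x, ∫ s in (0 : ℝ)..x, (2 * ((WithLp.toLp 2 (((1 / 2 : ℝ) • a), b)).fst : ℝ → ℝ) s -
      prim ((WithLp.toLp 2 (((1 / 2 : ℝ) • a), b)).snd : ℝ → ℝ) s) = x * vp.1.1 0 := by
    intro x
    rw [hsnd, hprimb]
    have hcongr : ∫ s in (0 : ℝ)..x, (2 * ((WithLp.toLp 2 (((1 / 2 : ℝ) • a), b)).fst : ℝ → ℝ) s - (vp.1.1 s - vp.1.1 0)) =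
        ∫ s in (0 : ℝ)..x, vp.1.1 0 :=
      intervalIntegral.integral_congr_ae (hfst.mono fun y hy _ => by rw [hy]; ring)
    rw [hcongr, intervalIntegral.integral_const, smul_eq_mul, sub_zero]
  rw [mem_EspE_iff]
  refine ⟨fun x => ?_, fun x => ?_, ?_⟩
  · rw [hF x, hF 1, one_mul]
  · rw [hsnd, hprimb]
    simp only [vp.2.1.even x]
  · have hfst' : ((WithLp.toLp 2 (((1 / 2 : ℝ) • a), b)).fst : ℝ → ℝ) =ᵐ[volume] fun y => (1 / 2) * vp.1.1 y := hfst
    rw [integral_congr_ae hfst', integral_const_mul, vp.2.2, mul_zero]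

/-- **The embedding of the zero-mass even tests into the even energy space**, `(v, v₁) ↦ (½v, v₁)`. [folklore] -/
def jmapE {L : ℝ} (hL : 0 < L) : testSpaceE0 →ₗ[ℝ] EspE L hL where
  toFun vp := ⟨WithLp.toLp 2 (((1 / 2 : ℝ) • (memLp_W_of_any (L := L) vp.2.1.toIsCompactTestAny).1.toLp vp.1.1),
      (memLp_W_of_any (L := L) vp.2.1.toIsCompactTestAny).2.toLp vp.1.2), jmapE_mem hL vp⟩
  map_add' vp vq := by
    apply Subtype.ext
    simp only [Submodule.coe_add]
    have h1 : ((memLp_W_of_any (L := L) (vp + vq).2.1.toIsCompactTestAny).1.toLp ((vp : (ℝ → ℝ) × (ℝ → ℝ)) + vq).1 : W L) =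
        (memLp_W_of_any (L := L) vp.2.1.toIsCompactTestAny).1.toLp vp.1.1 +
          (memLp_W_of_any (L := L) vq.2.1.toIsCompactTestAny).1.toLp vq.1.1 := by
      rw [← MemLp.toLp_add]; rfl
    have h2 : ((memLp_W_of_any (L := L) (vp + vq).2.1.toIsCompactTestAny).2.toLp ((vp : (ℝ → ℝ) × (ℝ → ℝ)) + vq).2 : W L) =
        (memLp_W_of_any (L := L) vp.2.1.toIsCompactTestAny).2.toLp vp.1.2 +
          (memLp_W_of_any (L := L) vq.2.1.toIsCompactTestAny).2.toLp vq.1.2 := by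
      rw [← MemLp.toLp_add]; rfl
    rw [h1, h2, ← WithLp.toLp_add, Prod.mk_add_mk, smul_add]
  map_smul' c vp := by
    apply Subtype.ext
    simp only [Submodule.coe_smul, RingHom.id_apply]
    have h1 : ((memLp_W_of_any (L := L) (c • vp).2.1.toIsCompactTestAny).1.toLp (c • (vp : (ℝ → ℝ) × (ℝ → ℝ))).1 : W L) =
        c • (memLp_W_of_any (L := L) vp.2.1.toIsCompactTestAny).1.toLp vp.1.1 := by
      rw [← MemLp.toLp_const_smul]; rfl
    have h2 : ((memLp_W_of_any (L := L) (c • vp).2.1.toIsCompactTestAny).2.toLp (c • (vp : (ℝ → ℝ) × (ℝ → ℝ))).2 : W L) =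
        c • (memLp_W_of_any (L := L) vp.2.1.toIsCompactTestAny).2.toLp vp.1.2 := by
      rw [← MemLp.toLp_const_smul]; rfl
    rw [h1, h2, ← WithLp.toLp_smul, Prod.smul_mk, smul_comm c (1 / 2 : ℝ)]

/-- Components of `jmapE`: the second component is the `L²_w` class of `v₁` … [folklore] -/
theorem jmapE_snd {L : ℝ} (hL : 0 < L) (vp : testSpaceE0) :
    ((jmapE hL vp : EspE L hL) : WithLp 2 (W L × W L)).snd = (memLp_W_of_any (L := L) vp.2.1.toIsCompactTestAny).2.toLp vp.1.2 := rfl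

/-- … and the first is `½` times the class of `v`. [folklore] -/
theorem jmapE_fst {L : ℝ} (hL : 0 < L) (vp : testSpaceE0) :
    ((jmapE hL vp : EspE L hL) : WithLp 2 (W L × W L)).fst =
      (1 / 2 : ℝ) • (memLp_W_of_any (L := L) vp.2.1.toIsCompactTestAny).1.toLp vp.1.1 := rfl

/-- Read-back: `(jmapE vp).snd = v₁` a.e., `prim (jmapE vp).snd = v − v(0)` and `profile (jmapE vp) = v` everywhere. [folklore] -/
theorem jmapE_snd_ae {L : ℝ} (hL : 0 < L) (vp : testSpaceE0) :
    ((((jmapE hL vp : EspE L hL) : WithLp 2 (W L × W L)).snd : W L) : ℝ → ℝ) =ᵐ[volume] vp.1.2 ∧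
      (prim ((((jmapE hL vp : EspE L hL) : WithLp 2 (W L × W L)).snd : W L) : ℝ → ℝ) = fun x => vp.1.1 x - vp.1.1 0) ∧
      profile (jmapE hL vp) = vp.1.1 := by
  obtain ⟨-, hprim, -, -⟩ := basic_of_any vp.2.1.toIsCompactTestAny
  have hae : ((((jmapE hL vp : EspE L hL) : WithLp 2 (W L × W L)).snd : W L) : ℝ → ℝ) =ᵐ[volume] vp.1.2 := by
    rw [jmapE_snd]; exact ae_volume_of_ae_μw hL (MemLp.coeFn_toLp _)
  have hprim' : prim ((((jmapE hL vp : EspE L hL) : WithLp 2 (W L × W L)).snd : W L) : ℝ → ℝ) = fun x => vp.1.1 x - vp.1.1 0 := by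
    rw [prim_congr_ae hae]; funext x; exact hprim x
  have hfst : ((((jmapE hL vp : EspE L hL) : WithLp 2 (W L × W L)).fst : W L) : ℝ → ℝ) =ᵐ[volume] fun y => (1 / 2) * vp.1.1 y := by
    rw [jmapE_fst]
    have hae_a : (((memLp_W_of_any (L := L) vp.2.1.toIsCompactTestAny).1.toLp vp.1.1 : W L) : ℝ → ℝ) =ᵐ[volume] vp.1.1 :=
      ae_volume_of_ae_μw hL (MemLp.coeFn_toLp _)
    have h1 : (((1 / 2 : ℝ) • (memLp_W_of_any (L := L) vp.2.1.toIsCompactTestAny).1.toLp vp.1.1 : W L) : ℝ → ℝ) =ᵐ[volume]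
        fun y => (1 / 2) * (((memLp_W_of_any (L := L) vp.2.1.toIsCompactTestAny).1.toLp vp.1.1 : W L) : ℝ → ℝ) y :=
      (ae_volume_of_ae_μw hL (Lp.coeFn_smul (1 / 2 : ℝ) _)).mono fun y hy => by rw [hy, Pi.smul_apply, smul_eq_mul]
    exact h1.trans (hae_a.mono fun y hy => by simp only [hy])
  have hbase : baseConst (jmapE hL vp) = vp.1.1 0 := by
    simp only [baseConst]
    rw [hprim']
    have hcongr : ∫ s in (0 : ℝ)..1, (2 * ((((jmapE hL vp : EspE L hL) : WithLp 2 (W L × W L)).fst : W L) : ℝ → ℝ) s -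
        (vp.1.1 s - vp.1.1 0)) = ∫ s in (0 : ℝ)..1, vp.1.1 0 :=
      intervalIntegral.integral_congr_ae (hfst.mono fun y hy _ => by rw [hy]; ring)
    rw [hcongr, intervalIntegral.integral_const, smul_eq_mul, sub_zero, one_mul]
  refine ⟨hae, hprim', ?_⟩
  funext x
  simp only [profile, hbase, hprim']
  ring

/-- **The energy norm of a zero-mass even test**: `‖jmapE (v, v₁)‖² = ¼∫(L²+ξ²)v² + ∫(L²+ξ²)v₁²`. [folklore] -/
theorem sq_norm_jmapE {L : ℝ} (hL : 0 < L) (vp : testSpaceE0) :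
    ‖jmapE hL vp‖ ^ 2 = 1 / 4 * (∫ y, (L ^ 2 + y ^ 2) * vp.1.1 y ^ 2) + ∫ y, (L ^ 2 + y ^ 2) * vp.1.2 y ^ 2 := by
  have hn : ‖jmapE hL vp‖ = ‖((jmapE hL vp : EspE L hL) : WithLp 2 (W L × W L))‖ := rfl
  rw [hn, WithLp.prod_norm_sq_eq_of_L2, jmapE_fst, jmapE_snd, norm_smul, mul_pow, sq_norm_W, sq_norm_W]
  have hae_a : (((memLp_W_of_any (L := L) vp.2.1.toIsCompactTestAny).1.toLp vp.1.1 : W L) : ℝ → ℝ) =ᵐ[volume] vp.1.1 :=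
    ae_volume_of_ae_μw hL (MemLp.coeFn_toLp _)
  have hae_b : (((memLp_W_of_any (L := L) vp.2.1.toIsCompactTestAny).2.toLp vp.1.2 : W L) : ℝ → ℝ) =ᵐ[volume] vp.1.2 :=
    ae_volume_of_ae_μw hL (MemLp.coeFn_toLp _)
  have e1 : ∫ y, (L ^ 2 + y ^ 2) * (((memLp_W_of_any (L := L) vp.2.1.toIsCompactTestAny).1.toLp vp.1.1 : W L) : ℝ → ℝ) y ^ 2 =
      ∫ y, (L ^ 2 + y ^ 2) * vp.1.1 y ^ 2 := integral_congr_ae (hae_a.mono fun y hy => by simp only [hy])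
  have e2 : ∫ y, (L ^ 2 + y ^ 2) * (((memLp_W_of_any (L := L) vp.2.1.toIsCompactTestAny).2.toLp vp.1.2 : W L) : ℝ → ℝ) y ^ 2 =
      ∫ y, (L ^ 2 + y ^ 2) * vp.1.2 y ^ 2 := integral_congr_ae (hae_b.mono fun y hy => by simp only [hy])
  rw [e1, e2]
  norm_num

end SheetREvenEnergySpace
end Summit.NavierStokesRegularity.OSWSelfSimilar

end
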